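import Summits.CriticalPhenomena.Ising3D.TaylorRegionCheckHybrid
import Mathlib.Tactic.Linarith
import Mathlib.Tactic.Positivity
import Mathlib.Tactic.Ring
import HarnessLib

/-!
# Hybrid region checks, LOCAL-PRODUCT form of the discriminant
(cell `pub-ising3x`, seat recog-1 gen 11; gate (g2) — repair of a MEASURED weakness of `TaylorRegionCheckHybrid`)

HONEST FRAMING: lottery ticket; floor = tightest certified 3D Ising CFT bounds; no exact-solution
claim without a proof. Island framing: certified exclusion region at stated derivative order and
assumptions; not a determination of the 3D Ising critical exponents beyond that.

MEASURED on a real `Λ = 11` functional (seat notes, uncertified floats drive only the design): the even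
discriminant row `RD = 4·RX·RY − RZ²` of `EvenRegionDataH.check`, EXPANDED as an interval polynomial in `E`
(degree 22, monomial basis at `E = 0`) and then Taylor-shifted by `posOn`, loses all precision: the
shift to a centre `m ∈ [40, 300]` amplifies coefficient widths by `≈ m^22` while the value has cancelled by
`≈ 10^21` (point box at scale `2^60`: enclosure width `8·10^17` against a value `7·10^13`; a box of width `10⁻⁴`
in `Δσ` fails at any scale). The rows `RX`, `RY` themselves are fine (relative width `1.4·10⁻³` at box width
`10⁻⁴`). REPAIR (Moore 1966, Ch. 3, "dependency problem"): never expand the product — shift the three rows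
to the centre FIRST and multiply the shifted (local) polynomials: `dLocI`. Same for the `(E, θ)` tail: per
θ-cell the column enclosures of `TX`, `TY`, `TZ` are shifted to `P₁` separately and the discriminant is formed
from the shifted rows (`cellOKD`, `halfStripPosD`). `EvenRegionDataH.checkL` is `check` with these two
replacements (same data structure); **`taylorEvenRegion_of_evenRegionCheckHL`** has the statement of
`taylorEvenRegion_of_evenRegionCheckH`. The odd-cone check has no products of rows and is unchanged.
Elementary. [folklore]
-/

namespace Summit.CriticalPhenomena.Ising3D

open Finset Set
open Literature.Analysis.ValidatedNumerics Literature.Analysis.ValidatedNumerics.PolyMP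
open Literature.Analysis.ValidatedNumerics.NumericsMP (MI)
open Literature.MathematicalPhysics.QuantumFieldTheory.ConformalBootstrap3D

/-! ### The local discriminant polynomial -/

/-- `4·X(c+t)·Y(c+t) − Z(c+t)²` as an interval polynomial in the LOCAL variable `t`: shift first, multiply
after. [folklore] -/
def dLocI (S : ℕ) (RX RY RZ : IPoly) (C : MI) : IPoly :=
  addI (smulQI 4 (mulI S (shiftI S RX C) (shiftI S RY C)))
    (smulIntI (-1) (mulI S (shiftI S RZ C) (shiftI S RZ C)))

/-- Real shadow of `dLocI`. [folklore] -/
noncomputable def dLocR (ax ay az : List ℝ) (c : ℝ) : List ℝ :=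
  addR (smulR 4 (mulR (shiftR ax c) (shiftR ay c)))
    (smulR ((-1 : ℤ) : ℝ) (mulR (shiftR az c) (shiftR az c)))

/-- [folklore] -/
theorem pmem_dLocI {S : ℕ} (hS : 0 < S) {c : ℝ} {C : MI} (hc : MI.mem S c C) {ax ay az : List ℝ}
    {RX RY RZ : IPoly} (hx : PMem S ax RX) (hy : PMem S ay RY) (hz : PMem S az RZ) :
    PMem S (dLocR ax ay az c) (dLocI S RX RY RZ C) :=
  pmem_addI (pmem_smulQI (4 : ℚ) (r := 4) (by norm_num)
      (pmem_mulI hS (pmem_shiftI hS hc hx) (pmem_shiftI hS hc hy)))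
    (pmem_smulIntI (-1 : ℤ) (pmem_mulI hS (pmem_shiftI hS hc hz) (pmem_shiftI hS hc hz)))

/-- [folklore] -/
theorem evalR_dLocR (ax ay az : List ℝ) (c t : ℝ) :
    evalR (dLocR ax ay az c) t =
      4 * (evalR ax (c + t) * evalR ay (c + t)) - evalR az (c + t) * evalR az (c + t) := by
  simp only [dLocR, evalR_addR, evalR_smulR, evalR_mulR, evalR_shiftR, Int.cast_neg, Int.cast_one]
  ring

/-! ### Local sign tests on a bounded interval -/

/-- Core test on `[lo, hi]`: the local discriminant polynomial at the midpoint is positive on `[-hw, hw]`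
(`posCore` of the interval-polynomial library). [folklore] -/
def posCoreD (S : ℕ) (RX RY RZ : IPoly) (lo hi : ℚ) : Bool :=
  posCore S (dLocI S RX RY RZ (PolyMP.ofRat S ((lo + hi) / 2))) (-((hi - lo) / 2)) ((hi - lo) / 2)

/-- [folklore] -/
theorem posCoreD_sound {S : ℕ} (hS : 0 < S) {RX RY RZ : IPoly} {lo hi : ℚ}
    (h : posCoreD S RX RY RZ lo hi = true) (hle : lo ≤ hi) {ax ay az : List ℝ} (hx : PMem S ax RX)
    (hy : PMem S ay RY) (hz : PMem S az RZ) {x : ℝ} (hlo : (lo : ℝ) ≤ x) (hhi : x ≤ hi) :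
    evalR az x * evalR az x < 4 * (evalR ax x * evalR ay x) := by
  have hpm := pmem_dLocI hS (mem_ofRat S ((lo + hi) / 2)) hx hy hz
  have hw : -((hi - lo) / 2) ≤ (hi - lo) / 2 := by linarith
  have h1 : ((-((hi - lo) / 2) : ℚ) : ℝ) ≤ x - (((lo + hi) / 2 : ℚ) : ℝ) := by push_cast; linarith
  have h2 : x - (((lo + hi) / 2 : ℚ) : ℝ) ≤ (((hi - lo) / 2 : ℚ) : ℝ) := by push_cast; linarith
  have hpos := posCore_sound hS h hw hpm h1 h2
  rw [evalR_dLocR, show (((lo + hi) / 2 : ℚ) : ℝ) + (x - (((lo + hi) / 2 : ℚ) : ℝ)) = x by ring] at hpos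
  linarith

/-- Bisection to depth `d`. [folklore] -/
def posOnD (S : ℕ) (RX RY RZ : IPoly) : ℕ → ℚ → ℚ → Bool
  | 0, a, b => posCoreD S RX RY RZ a b
  | d + 1, a, b =>
      posCoreD S RX RY RZ a b ||
        (posOnD S RX RY RZ d a ((a + b) / 2) && posOnD S RX RY RZ d ((a + b) / 2) b)

/-- **Soundness of the local discriminant checker.** [folklore] -/
theorem posOnD_sound {S : ℕ} (hS : 0 < S) {RX RY RZ : IPoly} {ax ay az : List ℝ} (hx : PMem S ax RX)
    (hy : PMem S ay RY) (hz : PMem S az RZ) : ∀ {d : ℕ} {lo hi : ℚ},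
    posOnD S RX RY RZ d lo hi = true → lo ≤ hi →
      ∀ {x : ℝ}, (lo : ℝ) ≤ x → x ≤ hi → evalR az x * evalR az x < 4 * (evalR ax x * evalR ay x)
  | 0, _, _, h, hle, _, hlo, hhi => posCoreD_sound hS h hle hx hy hz hlo hhi
  | d + 1, a, b, h, hle, x, hlo, hhi => by
      simp only [posOnD, Bool.or_eq_true, Bool.and_eq_true] at h
      rcases h with h | ⟨h1, h2⟩
      · exact posCoreD_sound hS h hle hx hy hz hlo hhi
      · have hm1 : a ≤ (a + b) / 2 := by linarith
        have hm2 : (a + b) / 2 ≤ b := by linarith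
        have hmR : (((a + b) / 2 : ℚ) : ℝ) = ((a : ℝ) + b) / 2 := by push_cast; ring
        rcases le_or_gt x (((a : ℝ) + b) / 2) with hxm | hxm
        · exact posOnD_sound hS hx hy hz h1 hm1 hlo (by rw [hmR]; exact hxm)
        · exact posOnD_sound hS hx hy hz h2 hm2 (by rw [hmR]; exact hxm.le) hhi

/-- Row test on `[max(E₀, j), E₁]`, skipped when that interval is empty. [folklore] -/
def rowPosD (S dP : ℕ) (RX RY RZ : IPoly) (E0 E1 : ℚ) (j : ℕ) : Bool :=
  decide (E1 < max E0 (j : ℚ)) || posOnD S RX RY RZ dP (max E0 (j : ℚ)) E1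

/-- [folklore] -/
theorem disc_of_rowPosD {S : ℕ} (hS : 0 < S) {dP : ℕ} {RX RY RZ : IPoly} {E0 E1 : ℚ} {j : ℕ}
    (h : rowPosD S dP RX RY RZ E0 E1 j = true) {ax ay az : List ℝ} (hx : PMem S ax RX) (hy : PMem S ay RY)
    (hz : PMem S az RZ) {E : ℝ} (hE0 : (E0 : ℝ) ≤ E) (hjE : (j : ℝ) ≤ E) (hE1 : E ≤ E1) :
    evalR az E * evalR az E < 4 * (evalR ax E * evalR ay E) := by
  simp only [rowPosD, Bool.or_eq_true, decide_eq_true_eq] at h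
  have hlo : ((max E0 (j : ℚ) : ℚ) : ℝ) ≤ E := by push_cast; exact max_le hE0 hjE
  rcases h with hvac | hpos
  · exfalso
    have : ((E1 : ℚ) : ℝ) < ((max E0 (j : ℚ) : ℚ) : ℝ) := by exact_mod_cast hvac
    linarith
  · have hle : max E0 (j : ℚ) ≤ E1 := by
      have : ((max E0 (j : ℚ) : ℚ) : ℝ) ≤ (E1 : ℝ) := hlo.trans hE1
      exact_mod_cast this
    exact posOnD_sound hS hx hy hz hpos hle hlo hE1

/-! ### Tail: the local discriminant per θ-cell -/

/-- Per θ-cell test: the columns of the three tables enclosed on the cell; tail `P ≥ P₁` by `posLead` of the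
local discriminant at `P₁`, box part `[P₀, P₁]` by `posOnD`. [folklore] -/
def cellOKD (S : ℕ) (HX HY HZ : IPoly2) (MX MY MZ : ℕ) (P0 P1 c h : ℚ) (dP : ℕ) : Bool :=
  posLead (dLocI S (colEncl S HX MX c h) (colEncl S HY MY c h) (colEncl S HZ MZ c h) (PolyMP.ofRat S P1)) &&
    (decide (P1 ≤ P0) ||
      posOnD S (colEncl S HX MX c h) (colEncl S HY MY c h) (colEncl S HZ MZ c h) dP P0 P1)

/-- **Half-strip discriminant checker** on `{P ≥ P₀} × [0, θhi]`: `Z² < 4XY`. [folklore] -/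
def halfStripPosD (S : ℕ) (HX HY HZ : IPoly2) (P0 : ℚ) (prm : HSParams) : Bool :=
  decide (0 < prm.θhi) && decide (0 < prm.nθ) &&
    (List.range prm.nθ).all fun k =>
      cellOKD S HX HY HZ (effCols HX (rowMax2I HX)) (effCols HY (rowMax2I HY)) (effCols HZ (rowMax2I HZ))
        P0 prm.P1 (prm.θhi * (2 * (k : ℚ) + 1) / (2 * (prm.nθ : ℚ))) (prm.θhi / (2 * (prm.nθ : ℚ))) prm.dP

/-- **Soundness of the half-strip discriminant checker.** [folklore] -/
theorem halfStripPosD_sound {S : ℕ} (hS : 0 < S) {GX GY GZ : List (List ℝ)} {HX HY HZ : IPoly2}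
    (hGX : PMem2 S GX HX) (hGY : PMem2 S GY HY) (hGZ : PMem2 S GZ HZ) {P0 : ℚ} {prm : HSParams}
    (h : halfStripPosD S HX HY HZ P0 prm = true) {P θ : ℝ} (hP : (P0 : ℝ) ≤ P) (hθ0 : 0 ≤ θ)
    (hθ1 : θ ≤ prm.θhi) : eval2 GZ P θ * eval2 GZ P θ < 4 * (eval2 GX P θ * eval2 GY P θ) := by
  have hszX : rowMax2 GX ≤ rowMax2I HX := (rowMax2_eq_of_pmem2 hGX).le
  have hszY : rowMax2 GY ≤ rowMax2I HY := (rowMax2_eq_of_pmem2 hGY).le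
  have hszZ : rowMax2 GZ ≤ rowMax2I HZ := (rowMax2_eq_of_pmem2 hGZ).le
  simp only [halfStripPosD, Bool.and_eq_true, decide_eq_true_eq] at h
  obtain ⟨⟨hη, hn⟩, hall⟩ := h
  -- locate the θ-cell
  have hnR : (0 : ℝ) < prm.nθ := by exact_mod_cast hn
  have hn1 : prm.nθ - 1 + 1 = prm.nθ := Nat.sub_add_cancel hn
  obtain ⟨k, hk, hk1, hk2⟩ := exists_mem_gridCell (fun k : ℕ => (prm.θhi : ℝ) * k / prm.nθ) (prm.nθ - 1)
    (Δ := θ) (by simpa using hθ0) (by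
      show θ ≤ (prm.θhi : ℝ) * ((prm.nθ - 1 + 1 : ℕ) : ℝ) / prm.nθ
      rw [hn1, mul_div_assoc, div_self hnR.ne', mul_one]; exact hθ1)
  have hk1' : (prm.θhi : ℝ) * k / prm.nθ ≤ θ := hk1
  have hk2' : θ ≤ (prm.θhi : ℝ) * ((k : ℝ) + 1) / prm.nθ := by
    have : θ ≤ (prm.θhi : ℝ) * ((k + 1 : ℕ) : ℝ) / prm.nθ := hk2
    push_cast at this; exact this
  have hkn : k < prm.nθ := by omega
  have hcell := List.all_eq_true.mp hall k (List.mem_range.mpr hkn)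
  simp only [cellOKD, Bool.and_eq_true, Bool.or_eq_true, decide_eq_true_eq] at hcell
  obtain ⟨htail, hbox⟩ := hcell
  have hid1 : (prm.θhi : ℝ) * (2 * (k : ℝ) + 1) / (2 * prm.nθ) - prm.θhi / (2 * prm.nθ) =
      (prm.θhi : ℝ) * k / prm.nθ := by field_simp; ring
  have hid2 : (prm.θhi : ℝ) * (2 * (k : ℝ) + 1) / (2 * prm.nθ) + prm.θhi / (2 * prm.nθ) =
      (prm.θhi : ℝ) * ((k : ℝ) + 1) / prm.nθ := by field_simp; ring
  have hc : |θ - ((prm.θhi * (2 * (k : ℚ) + 1) / (2 * (prm.nθ : ℚ)) : ℚ) : ℝ)| ≤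
      ((prm.θhi / (2 * (prm.nθ : ℚ)) : ℚ) : ℝ) := by
    push_cast; rw [abs_le]; constructor <;> linarith
  have hh0 : (0 : ℚ) ≤ prm.θhi / (2 * (prm.nθ : ℚ)) := by
    have : (0 : ℚ) < prm.nθ := by exact_mod_cast hn
    positivity
  have hpmX := pmem_colEncl hS hGX (effCols HX (rowMax2I HX)) hh0 hc
  have hpmY := pmem_colEncl hS hGY (effCols HY (rowMax2I HY)) hh0 hc
  have hpmZ := pmem_colEncl hS hGZ (effCols HZ (rowMax2I HZ)) hh0 hc
  rw [← evalR_colVals_eff hS hGX hszX P θ, ← evalR_colVals_eff hS hGY hszY P θ,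
    ← evalR_colVals_eff hS hGZ hszZ P θ]
  by_cases hPP : (prm.P1 : ℝ) ≤ P
  · -- unbounded part: local discriminant at P₁, signs
    have hsh := pmem_dLocI hS (mem_ofRat S prm.P1) hpmX hpmY hpmZ
    have hpos := evalR_pos_of_posLead hS hsh htail (y := P - prm.P1) (by linarith)
    rw [evalR_dLocR, show (prm.P1 : ℝ) + (P - prm.P1) = P by ring] at hpos
    linarith
  · have hlt : P < (prm.P1 : ℝ) := lt_of_not_ge hPP
    rcases hbox with hvac | hposk
    · exact absurd ((show ((prm.P1 : ℚ) : ℝ) ≤ (P0 : ℝ) by exact_mod_cast hvac).trans hP) hPP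
    · have hP0P1 : P0 ≤ prm.P1 := by
        have : (P0 : ℝ) ≤ prm.P1 := hP.trans hlt.le
        exact_mod_cast this
      exact posOnD_sound hS hpmX hpmY hpmZ hposk hP0P1 hP hlt.le

/-! ### Even sector, hybrid, local-product form -/

namespace EvenRegionDataH

/-- **The hybrid even-region check, LOCAL-PRODUCT form**: `check` with the discriminant row decided by `rowPosD`
and the discriminant tail by `halfStripPosD` (the product is never expanded in the monomial basis). [folklore] -/
def checkL (d : EvenRegionDataH) : Bool :=
  decide (0 < d.S) && decide (0 < d.E0) && decide (d.E1 ≤ (d.J1 : ℚ) + 1) && momLenOK d.N d.R &&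
  kernelSizeOK d.S (d.cQ 0) (-1) d.sσI d.ccQ d.l d.N && kernelSizeOK d.S (d.cQ 1) (-1) d.sεI d.ccQ d.l d.N &&
  kernelSizeOK d.S (d.cQ 3) (-1) d.sbI d.ccQ d.l d.N && kernelSizeOK d.S (d.cQ 4) 1 d.sbI d.ccQ d.l d.N &&
  decide (1 ≤ d.prmX.θhi) && decide (1 ≤ d.prmY.θhi) && decide (1 ≤ d.prmD.θhi) &&
  halfStripPos2 d.S d.TX (d.E1 - d.ccQ) d.prmX && halfStripPos2 d.S d.TY (d.E1 - d.ccQ) d.prmY &&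
  halfStripPosD d.S d.TX d.TY d.TZ (d.E1 - d.ccQ) d.prmD &&
  (List.range (d.J1 + 1)).all fun j =>
    rowPos d.S d.dPj (d.RX j) d.E0 d.E1 j && rowPos d.S d.dPj (d.RY j) d.E0 d.E1 j &&
      rowPosD d.S d.dPj (d.RX j) (d.RY j) (d.RZ j) d.E0 d.E1 j

end EvenRegionDataH

/-- **The even region from the local-product hybrid check** (statement of `taylorEvenRegion_of_evenRegionCheckH`).
[folklore] -/
theorem taylorEvenRegion_of_evenRegionCheckHL (d : EvenRegionDataH) (hl : d.l.Nodup) (Q : Set (ℝ × ℝ))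
    (hQ : ∀ p ∈ Q, MI.mem d.S p.1 d.sσI ∧ MI.mem d.S p.2 d.sεI ∧ MI.mem d.S ((p.1 + p.2) / 2) d.sbI)
    (h : d.checkL = true) :
    TaylorEvenRegion (taylorCrossing (1 / 2) (1 / 2) d.l.toFinset fun i ab => (d.cQ i ab : ℝ)) Q ((d.E0 : ℚ) : ℝ) := by
  simp only [EvenRegionDataH.checkL, Bool.and_eq_true, decide_eq_true_eq] at h
  obtain ⟨⟨⟨⟨⟨⟨⟨⟨⟨⟨⟨⟨⟨⟨hS, hE0⟩, hJ1⟩, hR⟩, hN0⟩, hN1⟩, hN3⟩, hN4⟩, hθX⟩, hθY⟩, hθD⟩, hX⟩, hY⟩, hD⟩, hrows⟩ := h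
  refine taylorEvenRegion_half_of_qRegion _ _ Q _ fun p hp E j hE hj => ?_
  obtain ⟨hsσ, hsε, hsb⟩ := hQ p hp
  have hEpos : 0 < E := lt_of_lt_of_le (by exact_mod_cast hE0) hE
  by_cases hE1 : ((d.E1 : ℚ) : ℝ) ≤ E
  · -- tail: (E, θ) tables from E₁ on
    have hθ := div_mem_unit hEpos hj
    have hP : ((d.E1 - d.ccQ : ℚ) : ℝ) ≤ E - d.ccQ := by push_cast; linarith
    have eX := qSum_eq_eval2_momTable hS (d.cQ 0) (-1) hsσ d.ccQ hl hN0 hR hEpos j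
    have eY := qSum_eq_eval2_momTable hS (d.cQ 1) (-1) hsε d.ccQ hl hN1 hR hEpos j
    have eZ3 := qSum_eq_eval2_momTable hS (d.cQ 3) (-1) hsb d.ccQ hl hN3 hR hEpos j
    have eZ4 := qSum_eq_eval2_momTable hS (d.cQ 4) 1 hsb d.ccQ hl hN4 hR hEpos j
    have pX := pmem2_momTableI hS (d.cQ 0) (-1) hsσ d.ccQ d.l d.N d.R
    have pY := pmem2_momTableI hS (d.cQ 1) (-1) hsε d.ccQ d.l d.N d.R
    have pZ := pmem2_add2I (pmem2_momTableI hS (d.cQ 3) (-1) hsb d.ccQ d.l d.N d.R)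
      (pmem2_momTableI hS (d.cQ 4) 1 hsb d.ccQ d.l d.N d.R)
    have vX := halfStripPos2_sound hS pX hX hP hθ.1 (hθ.2.trans (by exact_mod_cast hθX))
    have vY := halfStripPos2_sound hS pY hY hP hθ.1 (hθ.2.trans (by exact_mod_cast hθY))
    have vD := halfStripPosD_sound hS pX pY pZ hD hP hθ.1 (hθ.2.trans (by exact_mod_cast hθD))
    rw [eval2_add2] at vD
    simp only [Rat.cast_neg, Rat.cast_one] at eX eY eZ3 eZ4
    have goalD : (qSum (fun ab => (d.cQ 3 ab : ℝ)) d.l.toFinset ((p.1 + p.2) / 2) (-1) E j +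
        qSum (fun ab => (d.cQ 4 ab : ℝ)) d.l.toFinset ((p.1 + p.2) / 2) 1 E j) ^ 2 ≤
        4 * qSum (fun ab => (d.cQ 0 ab : ℝ)) d.l.toFinset p.1 (-1) E j *
          qSum (fun ab => (d.cQ 1 ab : ℝ)) d.l.toFinset p.2 (-1) E j := by
      rw [eX, eY, eZ3, eZ4, sq]; linarith
    exact ⟨by rw [eX]; exact vX.le, by rw [eY]; exact vY.le, goalD⟩
  · -- bounded part: exact rows at the integer j, discriminant in local form
    have hElt : E < d.E1 := lt_of_not_ge hE1
    have hjJ : j < d.J1 + 1 := by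
      have h1 : (j : ℝ) < (d.J1 : ℝ) + 1 := by
        have : ((d.E1 : ℚ) : ℝ) ≤ (d.J1 : ℝ) + 1 := by exact_mod_cast hJ1
        linarith
      exact_mod_cast h1
    have hrow := List.all_eq_true.mp hrows j (List.mem_range.mpr hjJ)
    simp only [Bool.and_eq_true] at hrow
    obtain ⟨⟨rX, rY⟩, rD⟩ := hrow
    have pX := pmem_qRowI hS (d.cQ 0) (-1) hsσ d.l j
    have pY := pmem_qRowI hS (d.cQ 1) (-1) hsε d.l j
    have pZ := pmem_addI (pmem_qRowI hS (d.cQ 3) (-1) hsb d.l j) (pmem_qRowI hS (d.cQ 4) 1 hsb d.l j)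
    have vX := pos_of_rowPos hS rX pX hE hj hElt.le
    have vY := pos_of_rowPos hS rY pY hE hj hElt.le
    have vD := disc_of_rowPosD hS rD pX pY pZ hE hj hElt.le
    rw [evalR_addR] at vD
    have eX := qSum_eq_evalR_qRow (d.cQ 0) (-1) p.1 hl j E
    have eY := qSum_eq_evalR_qRow (d.cQ 1) (-1) p.2 hl j E
    have eZ3 := qSum_eq_evalR_qRow (d.cQ 3) (-1) ((p.1 + p.2) / 2) hl j E
    have eZ4 := qSum_eq_evalR_qRow (d.cQ 4) 1 ((p.1 + p.2) / 2) hl j E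
    simp only [Rat.cast_neg, Rat.cast_one] at eX eY eZ3 eZ4
    have goalD : (qSum (fun ab => (d.cQ 3 ab : ℝ)) d.l.toFinset ((p.1 + p.2) / 2) (-1) E j +
        qSum (fun ab => (d.cQ 4 ab : ℝ)) d.l.toFinset ((p.1 + p.2) / 2) 1 E j) ^ 2 ≤
        4 * qSum (fun ab => (d.cQ 0 ab : ℝ)) d.l.toFinset p.1 (-1) E j *
          qSum (fun ab => (d.cQ 1 ab : ℝ)) d.l.toFinset p.2 (-1) E j := by
      rw [eX, eY, eZ3, eZ4, sq]; linarith
    exact ⟨by rw [eX]; exact vX.le, by rw [eY]; exact vY.le, goalD⟩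

/-! ### Fixture: the local-product pipeline runs in the kernel (toy `Λ = 1`, point box) -/

/-- Toy hybrid even data (the weights of the tree's toy even certificates; thin box inputs). [folklore] -/
def toyEvenRegionDataHL : EvenRegionDataH where
  S := 1024
  l := [(1, 0)]
  cQ := fun i _ => if i = 0 ∨ i = 1 then 1 else 0
  sσI := PolyMP.ofRat 1024 (1 / 2)
  sεI := PolyMP.ofRat 1024 (3 / 2)
  sbI := PolyMP.ofRat 1024 1
  E0 := 4
  E1 := 8
  J1 := 8
  ccQ := 0
  N := 2
  R := 5
  prmX := ⟨1, 8, 1, 3⟩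
  prmY := ⟨1, 8, 1, 3⟩
  prmD := ⟨1, 8, 1, 3⟩
  dPj := 3

/-- [folklore] -/
theorem toyEvenRegionDataHL_checkL : toyEvenRegionDataHL.checkL = true := by
  decide +kernel

end Summit.CriticalPhenomena.Ising3D
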